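import Literature.Combinatorics.SimpleGraph.HamiltonianPathCount
import HarnessLib

/-!
# A verified enumerator of Hamiltonian paths, for gadget censuses by kernel computation

Support for gadget reductions to Hamiltonian-path counting (Garey–Johnson–Tarjan 1976;
Liśkiewicz–Ogihara–Toda 2003, §3, Lemma 4), continuing `HamiltonianPathCount.lean`
(`IsHamPathOn G V s t l`, `hamCount`, `hamCountRF`). The local censuses of the gadgets of such
reductions ("there are four ways to do the former and two ways to do the latter (see Fig. 1b)";
"(4 · 2)⁴ = 2¹²"; "two ways to traverse all the nodes in the block") are statements about the
number of Hamiltonian paths of explicit graphs with 15–30 vertices. `hamCount` is a cardinality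
(`Set.ncard`) and enumerating the `15!` permutations is out of reach of `decide`; this file gives a
depth-first ENUMERATOR of simple paths and proves that it lists every Hamiltonian path exactly
once, so that such censuses reduce to `List.length` computations the kernel performs in a few
thousand steps:

* `extendRev adj vs p` — the one-vertex extensions of a reversed simple path `p` inside the vertex
  list `vs` along the Boolean adjacency `adj`;
* `pathsRev adj vs s k` — all reversed simple paths from `s` with `k + 1` vertices
  (`mem_pathsRev_iff`: exactly the lists satisfying `IsRevPath`; `nodup_pathsRev`: no repeats);
* `hamPathsList adj vs s t` — all Hamiltonian `s`–`t` vertex lists of the graph `adj` on `vs`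
  (`mem_hamPathsList_iff`, `nodup_hamPathsList`);
* **`hamCount_eq_length_hamPathsList`**, **`hamCountRF_eq_length_filter`** — for a simple graph
  `G` whose adjacency on `vs` is `adj`, `hamCount G vs.toFinset s t` is the length of the
  enumeration, and the constrained count `hamCountRF` is the length of the enumeration filtered
  by the required / forbidden edges.

Usage: `rw [hamCount_eq_length_hamPathsList …]; decide` (see `TutteFragment.lean`).

## References

* M. R. Garey, D. S. Johnson, R. E. Tarjan, SIAM J. Comput. 5 (1976) 704–714 (gadget censuses).
* M. Liśkiewicz, M. Ogihara, S. Toda, TCS 304 (2003) 129–156, §3, Figs. 1–3.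
-/

namespace Literature.Combinatorics.SimpleGraph

variable {α : Type*} [DecidableEq α]

/-! ### The enumerator -/

/-- **One extension step.** The reversed simple paths `w :: p` extending the reversed simple path
`p` (current end point first) by a vertex `w` of `vs` adjacent to the end point along `adj` and
not yet on `p`. [folklore] -/
def extendRev (adj : α → α → Bool) (vs : List α) (p : List α) : List (List α) :=
  match p with
  | [] => []
  | u :: _ => (vs.filter fun w => adj u w && decide (w ∉ p)).map fun w => w :: p

/-- **All reversed simple paths from `s` with `k + 1` vertices** (vertices in `vs`, steps along
`adj`), by iterated extension. [folklore] -/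
def pathsRev (adj : α → α → Bool) (vs : List α) (s : α) : ℕ → List (List α)
  | 0 => [[s]]
  | k + 1 => (pathsRev adj vs s k).flatMap (extendRev adj vs)

/-- **All Hamiltonian `s`–`t` vertex lists** of the graph with vertex list `vs` and adjacency
`adj`: the reversed simple paths from `s` with `|vs|` vertices that end at `t`, read forwards
(empty if `s ∉ vs`). [folklore] -/
def hamPathsList (adj : α → α → Bool) (vs : List α) (s t : α) : List (List α) :=
  if s ∈ vs then
    ((pathsRev adj vs s (vs.length - 1)).filter fun p => decide (p.head? = some t)).map List.reverse
  else []

/-- **`p` read backwards is a simple path from `s` with `k + 1` vertices** in `vs` along `adj`: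
the specification of the members of `pathsRev adj vs s k`. [folklore] -/
structure IsRevPath (adj : α → α → Bool) (vs : List α) (s : α) (k : ℕ) (p : List α) : Prop where
  /-- `k + 1` vertices -/
  length_eq : p.length = k + 1
  /-- the path starts (the reversed list ends) at `s` -/
  getLast?_eq : p.getLast? = some s
  /-- no vertex repeated -/
  nodup : p.Nodup
  /-- all vertices in `vs` -/
  subset : ∀ x ∈ p, x ∈ vs
  /-- consecutive vertices adjacent (read backwards) -/
  isChain : List.IsChain (fun a b => adj b a = true) p

/-! ### Specification of the enumerator -/

section spec

variable (adj : α → α → Bool) (vs : List α)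

/-- Members of an extension step. [folklore] -/
theorem mem_extendRev_iff {p q : List α} :
    p ∈ extendRev adj vs q ↔
      ∃ u q', q = u :: q' ∧ ∃ w, w ∈ vs ∧ adj u w = true ∧ w ∉ q ∧ p = w :: q := by
  unfold extendRev
  rcases q with _ | ⟨u, q'⟩
  · simp
  · simp only [List.mem_map, List.mem_filter, Bool.and_eq_true, decide_eq_true_eq,
      List.cons.injEq]
    constructor
    · rintro ⟨w, ⟨hw, hadj, hnot⟩, rfl⟩
      exact ⟨u, q', ⟨rfl, rfl⟩, w, hw, hadj, hnot, rfl⟩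
    · rintro ⟨u₁, q₁, ⟨rfl, rfl⟩, w, hw, hadj, hnot, rfl⟩
      exact ⟨w, ⟨hw, hadj, hnot⟩, rfl⟩

/-- **The enumerator is exact**: `pathsRev adj vs s k` lists exactly the reversed simple paths
from `s ∈ vs` with `k + 1` vertices. [folklore] -/
theorem mem_pathsRev_iff {s : α} (hs : s ∈ vs) :
    ∀ {k : ℕ} {p : List α}, p ∈ pathsRev adj vs s k ↔ IsRevPath adj vs s k p
  | 0, p => by
    simp only [pathsRev, List.mem_singleton]
    constructor
    · rintro rfl
      exact ⟨rfl, rfl, List.nodup_singleton s, fun x hx => by simpa [List.mem_singleton.1 hx],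
        List.isChain_singleton s⟩
    · rintro ⟨hlen, hlast, -, -, -⟩
      match p, hlen with
      | [x], _ => simpa using hlast
  | k + 1, p => by
    simp only [pathsRev, List.mem_flatMap]
    constructor
    · rintro ⟨q, hq, hp⟩
      have hq' := (mem_pathsRev_iff hs).1 hq
      obtain ⟨u, q', rfl, w, hw, hadj, hnot, rfl⟩ := (mem_extendRev_iff adj vs).1 hp
      refine ⟨by simp [hq'.length_eq], ?_, List.nodup_cons.2 ⟨hnot, hq'.nodup⟩, ?_, ?_⟩
      · rw [List.getLast?_cons_cons]
        exact hq'.getLast?_eq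
      · intro x hx
        rcases List.mem_cons.1 hx with rfl | hx
        exacts [hw, hq'.subset x hx]
      · exact List.isChain_cons_cons.2 ⟨hadj, hq'.isChain⟩
    · rintro ⟨hlen, hlast, hnd, hsub, hch⟩
      match p, hlen, hlast, hnd, hsub, hch with
      | w :: u :: q', hlen, hlast, hnd, hsub, hch =>
        have hq : IsRevPath adj vs s k (u :: q') :=
          ⟨by simpa using hlen, by rwa [List.getLast?_cons_cons] at hlast, hnd.of_cons,
            fun x hx => hsub x (List.mem_cons_of_mem _ hx), (List.isChain_cons_cons.1 hch).2⟩
        exact ⟨u :: q', (mem_pathsRev_iff hs).2 hq, (mem_extendRev_iff adj vs).2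
          ⟨u, q', rfl, w, hsub w (by simp), (List.isChain_cons_cons.1 hch).1,
            (List.nodup_cons.1 hnd).1, rfl⟩⟩

/-- Every member of an extension step of `q` has tail `q`. [folklore] -/
theorem tail_eq_of_mem_extendRev {p q : List α} (h : p ∈ extendRev adj vs q) : p.tail = q := by
  obtain ⟨-, -, -, w, -, -, -, rfl⟩ := (mem_extendRev_iff adj vs).1 h
  rfl

/-- An extension step lists no path twice (for `vs` without repeats). [folklore] -/
theorem nodup_extendRev (hvs : vs.Nodup) (q : List α) : (extendRev adj vs q).Nodup := by
  unfold extendRev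
  rcases q with _ | ⟨u, q'⟩
  · exact List.nodup_nil
  · exact (hvs.filter _).map fun a b h => (List.cons.inj h).1

/-- **The enumerator lists no path twice** (for `vs` without repeats). [folklore] -/
theorem nodup_pathsRev (hvs : vs.Nodup) (s : α) : ∀ k : ℕ, (pathsRev adj vs s k).Nodup
  | 0 => List.nodup_singleton _
  | k + 1 => by
    rw [pathsRev, List.nodup_flatMap]
    refine ⟨fun q _ => nodup_extendRev adj vs hvs q, (nodup_pathsRev hvs s k).imp ?_⟩
    intro q q' hne
    simp only [Function.onFun]
    rw [List.disjoint_left]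
    intro p hp hp'
    exact hne ((tail_eq_of_mem_extendRev adj vs hp).symm.trans
      (tail_eq_of_mem_extendRev adj vs hp'))

/-- **The Hamiltonian path enumerator is exact**: `hamPathsList adj vs s t` lists exactly the
vertex lists without repeats, of length `|vs|`, inside `vs`, from `s` to `t`, with consecutive
vertices adjacent along `adj`. [folklore] -/
theorem mem_hamPathsList_iff {s t : α} {l : List α} :
    l ∈ hamPathsList adj vs s t ↔
      l.Nodup ∧ (∀ x ∈ l, x ∈ vs) ∧ l.length = vs.length ∧ l.head? = some s ∧
        l.getLast? = some t ∧ List.IsChain (fun a b => adj a b = true) l := by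
  unfold hamPathsList
  split_ifs with hs
  · have hlen : vs.length - 1 + 1 = vs.length :=
      Nat.sub_add_cancel (List.length_pos_of_mem hs)
    constructor
    · rintro h
      obtain ⟨p, hp, rfl⟩ := List.mem_map.1 h
      obtain ⟨hp, ht⟩ := List.mem_filter.1 hp
      have hp' := (mem_pathsRev_iff adj vs hs).1 hp
      refine ⟨List.nodup_reverse.2 hp'.nodup, fun x hx => hp'.subset x (List.mem_reverse.1 hx),
        by rw [List.length_reverse, hp'.length_eq, hlen], by rw [List.head?_reverse, hp'.getLast?_eq],
        by rw [List.getLast?_reverse]; exact of_decide_eq_true ht, ?_⟩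
      exact List.isChain_reverse.2 hp'.isChain
    · rintro ⟨hnd, hsub, hl, hh, ht, hch⟩
      refine List.mem_map.2 ⟨l.reverse, List.mem_filter.2 ⟨(mem_pathsRev_iff adj vs hs).2
        ⟨by rw [List.length_reverse, hl, hlen], by rw [List.getLast?_reverse, hh],
          List.nodup_reverse.2 hnd, fun x hx => hsub x (List.mem_reverse.1 hx), ?_⟩, ?_⟩,
        List.reverse_reverse l⟩
      · exact List.isChain_reverse.2 (by simpa using hch)
      · rw [List.head?_reverse, ht]; exact decide_eq_true rfl
  · simp only [List.not_mem_nil, false_iff, not_and]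
    intro _ hsub _ hh
    exact absurd (hsub s (List.mem_of_mem_head? hh)) hs

/-- **The Hamiltonian path enumerator lists no path twice.** [folklore] -/
theorem nodup_hamPathsList (hvs : vs.Nodup) (s t : α) : (hamPathsList adj vs s t).Nodup := by
  unfold hamPathsList
  split_ifs with hs
  · exact ((nodup_pathsRev adj vs hvs s _).filter _).map List.reverse_injective
  · exact List.nodup_nil

end spec

/-! ### The counts as lengths of the enumeration -/

section count

variable (G : _root_.SimpleGraph α) (adj : α → α → Bool) (vs : List α)

/-- For a list `l` without repeats: `l.toFinset = vs.toFinset` iff `l ⊆ vs` and the lengths agree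
(`vs` without repeats). [folklore] -/
theorem toFinset_eq_iff_of_nodup {l : List α} (hl : l.Nodup) (hvs : vs.Nodup) :
    l.toFinset = vs.toFinset ↔ (∀ x ∈ l, x ∈ vs) ∧ l.length = vs.length := by
  constructor
  · intro h
    have hperm : l.Perm vs := List.perm_of_nodup_nodup_toFinset_eq hl hvs h
    exact ⟨fun x hx => hperm.subset hx, hperm.length_eq⟩
  · rintro ⟨hsub, hlen⟩
    exact List.toFinset_eq_of_perm _ _ ((hl.subperm hsub).perm_of_length_le hlen.ge)

/-- **Hamiltonian paths are the members of the enumeration**: for a simple graph `G` whose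
adjacency between vertices of `vs` is `adj`, `IsHamPathOn G vs.toFinset s t l ↔ l ∈ hamPathsList
adj vs s t`. [folklore] -/
theorem isHamPathOn_iff_mem_hamPathsList (hvs : vs.Nodup)
    (hadj : ∀ a ∈ vs, ∀ b ∈ vs, G.Adj a b ↔ adj a b = true) {s t : α} {l : List α} :
    IsHamPathOn G vs.toFinset s t l ↔ l ∈ hamPathsList adj vs s t := by
  rw [mem_hamPathsList_iff adj vs]
  unfold IsHamPathOn
  constructor
  · rintro ⟨hnd, hV, hh, ht, hch⟩
    obtain ⟨hsub, hlen⟩ := (toFinset_eq_iff_of_nodup vs hnd hvs).1 hV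
    refine ⟨hnd, hsub, hlen, hh, ht, ?_⟩
    rw [List.IsChain.iff_mem] at hch ⊢
    exact hch.imp fun a b ⟨ha, hb, h⟩ => ⟨ha, hb, (hadj a (hsub a ha) b (hsub b hb)).1 h⟩
  · rintro ⟨hnd, hsub, hlen, hh, ht, hch⟩
    refine ⟨hnd, (toFinset_eq_iff_of_nodup vs hnd hvs).2 ⟨hsub, hlen⟩, hh, ht, ?_⟩
    rw [List.IsChain.iff_mem] at hch ⊢
    exact hch.imp fun a b ⟨ha, hb, h⟩ => ⟨ha, hb, (hadj a (hsub a ha) b (hsub b hb)).2 h⟩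

/-- **`hamCountRF` by enumeration**: the number of Hamiltonian `s`–`t` paths of `G` through
`vs.toFinset` using every edge of `R` and no edge of `F` is the length of the enumeration
filtered by the constraints. [folklore] -/
theorem hamCountRF_eq_length_filter (hvs : vs.Nodup)
    (hadj : ∀ a ∈ vs, ∀ b ∈ vs, G.Adj a b ↔ adj a b = true) (s t : α) (R F : Finset (α × α)) :
    hamCountRF G vs.toFinset s t R F =
      ((hamPathsList adj vs s t).filter fun l =>
        decide ((∀ e ∈ R, Uses l e) ∧ ∀ e ∈ F, ¬ Uses l e)).length := by
  set L := (hamPathsList adj vs s t).filter fun l =>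
    decide ((∀ e ∈ R, Uses l e) ∧ ∀ e ∈ F, ¬ Uses l e) with hL
  have hset : hamSetRF G vs.toFinset s t R F = ↑L.toFinset := by
    ext l
    simp only [hamSetRF, Set.mem_setOf_eq, Finset.mem_coe, List.mem_toFinset, hL,
      List.mem_filter, decide_eq_true_eq, isHamPathOn_iff_mem_hamPathsList G adj vs hvs hadj]
  have hnd : L.Nodup := (nodup_hamPathsList adj vs hvs s t).filter _
  rw [hamCountRF, hset, Set.ncard_coe_finset, List.toFinset_card_of_nodup hnd]

/-- **`hamCount` by enumeration**: the number of Hamiltonian `s`–`t` paths of `G` through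
`vs.toFinset` is the length of the enumeration. [folklore] -/
theorem hamCount_eq_length_hamPathsList (hvs : vs.Nodup)
    (hadj : ∀ a ∈ vs, ∀ b ∈ vs, G.Adj a b ↔ adj a b = true) (s t : α) :
    hamCount G vs.toFinset s t = (hamPathsList adj vs s t).length := by
  rw [hamCount_eq, hamCountRF_eq_length_filter G adj vs hvs hadj s t ∅ ∅]
  congr 1
  exact List.filter_eq_self.2 fun l _ => by simp

/-- The whole-type form: for a finite vertex type enumerated by `vs` (every vertex listed once),
`hamCount G univ s t` is the length of the enumeration. [folklore] -/
theorem hamCount_univ_eq_length_hamPathsList [Fintype α] (hvs : vs.Nodup) (hall : ∀ x, x ∈ vs)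
    (hadj : ∀ a b, G.Adj a b ↔ adj a b = true) (s t : α) :
    hamCount G Finset.univ s t = (hamPathsList adj vs s t).length := by
  have huniv : vs.toFinset = Finset.univ := Finset.eq_univ_of_forall fun x =>
    List.mem_toFinset.2 (hall x)
  rw [← huniv]
  exact hamCount_eq_length_hamPathsList G adj vs hvs (fun a _ b _ => hadj a b) s t

/-- **Constraint test, required edges**: the path `l` uses every edge of the list `R`.
[cite: GareyJohnson1979, §3.2.2 (local replacement)] -/
def usesAll (l : List α) (R : List (α × α)) : Bool :=
  R.all fun e => decide (Uses l e)

/-- **Constraint test, forbidden edges**: the path `l` uses no edge of the list `F`.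
[cite: GareyJohnson1979, §3.2.2 (local replacement)] -/
def usesNone (l : List α) (F : List (α × α)) : Bool :=
  F.all fun e => !decide (Uses l e)

omit [DecidableEq α] in
/-- The Boolean constraint tests agree with the constraints of `hamSetRF` for constraint lists.
[folklore] -/
theorem usesAll_and_usesNone_eq_true_iff [DecidableEq α] (l : List α) (R F : List (α × α)) :
    (usesAll l R && usesNone l F) = true ↔ (∀ e ∈ R.toFinset, Uses l e) ∧ ∀ e ∈ F.toFinset, ¬ Uses l e := by
  simp [usesAll, usesNone, List.all_eq_true]

/-- **`hamCountRF` by enumeration, constraint lists**: with the required / forbidden edges given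
as lists, the constrained count is the length of the enumeration filtered by the Boolean tests
`usesAll` / `usesNone` (the form evaluated by `decide`). [folklore] -/
theorem hamCountRF_eq_length_filter_lists (hvs : vs.Nodup)
    (hadj : ∀ a ∈ vs, ∀ b ∈ vs, G.Adj a b ↔ adj a b = true) (s t : α) (R F : List (α × α)) :
    hamCountRF G vs.toFinset s t R.toFinset F.toFinset =
      ((hamPathsList adj vs s t).filter fun l => usesAll l R && usesNone l F).length := by
  rw [hamCountRF_eq_length_filter G adj vs hvs hadj s t R.toFinset F.toFinset]
  congr 1
  refine List.filter_congr fun l _ => ?_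
  rw [Bool.eq_iff_iff, decide_eq_true_iff, usesAll_and_usesNone_eq_true_iff]

/-- The whole-type form with constraint lists: for a finite vertex type enumerated by `vs`,
`hamCountRF G univ s t R.toFinset F.toFinset` is the length of the filtered enumeration.
[folklore] -/
theorem hamCountRF_univ_eq_length_filter_lists [Fintype α] (hvs : vs.Nodup) (hall : ∀ x, x ∈ vs)
    (hadj : ∀ a b, G.Adj a b ↔ adj a b = true) (s t : α) (R F : List (α × α)) :
    hamCountRF G Finset.univ s t R.toFinset F.toFinset =
      ((hamPathsList adj vs s t).filter fun l => usesAll l R && usesNone l F).length := by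
  have huniv : vs.toFinset = Finset.univ := Finset.eq_univ_of_forall fun x =>
    List.mem_toFinset.2 (hall x)
  rw [← huniv]
  exact hamCountRF_eq_length_filter_lists G adj vs hvs (fun a _ b _ => hadj a b) s t R F

end count

/-! ### Sanity checks -/

/-- The path graph `0 — 1 — 2` as a Boolean adjacency. [folklore] -/
def pathThreeAdj (a b : Fin 3) : Bool :=
  (a.val + 1 == b.val) || (b.val + 1 == a.val)

/-- The enumerator on the path `0 — 1 — 2`: one Hamiltonian path from `0` to `2`, none from `0`
to `1` (by `decide`). [folklore] -/
theorem hamPathsList_pathThree :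
    hamPathsList pathThreeAdj (List.finRange 3) 0 2 = [[0, 1, 2]] ∧
      hamPathsList pathThreeAdj (List.finRange 3) 0 1 = [] := by
  decide

end Literature.Combinatorics.SimpleGraph
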